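import Mathlib
import Summits.Ventures.PercRepro2.CoinChainPivotalMean
import Summits.Ventures.PercRepro2.CoinChainEnteredPart
import Summits.Ventures.PercRepro2.CoinChainWorld0Corner
import Summits.Ventures.PercRepro2.CoinChainCleanBaseChain
import Summits.Ventures.PercRepro2.CoinChainCleanBaseX
import Summits.Ventures.PercRepro2.CoinChainPivotalPart

/-!
# The universal pure AND-switch chain as ONE case analysis over six kernel conditions
(blind cell PercRepro2, night-2 g23; proofs/NIGHT2-DARC.md §63.14–63.16)

`pureChain_functional_nonneg_of_sixCases`: the pure chain functional is nonnegative at EVERY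
`ρ ∈ [0, 1]` whenever ONE of the six landed sign conditions holds — pivotalX / pivotalY
(`CoinChainPivotalMean`), the nonnegative entered part (`CoinChainEnteredPart`), the world-0
corner (`CoinChainWorld0Corner`), the clean-state base bounds in either layer cake
(`CoinChainCleanBaseChain`, `CoinChainCleanBaseX`) and the pivotal positive part
(`CoinChainPivotalPart`, any pointwise bound `θ`).  On the whole census (n = 3, 4: all pairs of
up-set markers; n = 5: point markers) the disjunction holds in every anti-aligned instance; its
exhaustiveness — a statement about the core and the gate alone — is the single open hypothesis
of the universal pure chain (§63.14).
-/

namespace Summit.Ventures.PercRepro2.Coin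

open Classical

section SixCases

variable {V : Type*} [DecidableEq V] {R : Type*} [Field R] [LinearOrder R] [IsStrictOrderedRing R]

/-- **THE UNIVERSAL PURE CHAIN BY SIX CASES** — one of the six kernel sign conditions holds ⟹ the
pure chain functional is nonnegative at every `ρ ∈ [0, 1]`. -/
theorem pureChain_functional_nonneg_of_sixCases
    (U ent' : Finset V) (ν c d d' : Finset V → R)
    (ρ : R) (hρ0 : 0 ≤ ρ) (hρ1 : ρ ≤ 1) (hν0 : ∀ W, 0 ≤ ν W)
    (hν : ∀ s ⊆ U, ∀ t ⊆ U, ν s * ν t ≤ ν (s ∩ t) * ν (s ∪ t))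
    (hc0 : ∀ W, 0 ≤ c W) (hd0 : ∀ W, 0 ≤ d W) (hd'0 : ∀ W, 0 ≤ d' W)
    (hdc : ∀ W, d W ≤ c W) (hd'c : ∀ W, d' W ≤ c W) (hd'd : ∀ W, d' W ≤ d W)
    (hcc : ∀ s t, c s * c t ≤ c (s ∩ t) * c (s ∪ t))
    (hdd : ∀ s t, d s * d t ≤ d (s ∩ t) * d (s ∪ t))
    (hd'd' : ∀ s t, d' s * d' t ≤ d' (s ∩ t) * d' (s ∪ t))
    (hcd : ∀ s t, c s * d t ≤ c (s ∩ t) * d (s ∪ t))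
    (hcd' : ∀ s t, c s * d' t ≤ c (s ∩ t) * d' (s ∪ t))
    (hdd' : ∀ s t, d s * d' t ≤ d (s ∩ t) * d' (s ∪ t))
    (hratio : ∀ s t, s ⊆ t → d s * c t ≤ c s * d t)
    (hratio' : ∀ s t, s ⊆ t → d' s * c t ≤ c s * d' t)
    (x y : Finset V → R) (hx0 : ∀ W, 0 ≤ x W) (hy0 : ∀ W, 0 ≤ y W)
    (hxm : ∀ s t, x s ≤ x (s ∪ t)) (hym : ∀ s t, y s ≤ y (s ∪ t))
    (hpos0 : 0 < ∑ W ∈ U.powerset, ν W * c W)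
    (hpos1 : 0 < ∑ W ∈ U.powerset, ν W * chainMix ∅ ent' 1 c d W)
    (hmI : 0 < ∑ W ∈ U.powerset.filter (fun W => ¬ ∃ r ∈ ent', r ∈ W), ν W * c W)
    (hcase : (((∑ W ∈ U.powerset, ν W * chainMix ∅ ent' 1 c d W) * (∑ W ∈ U.powerset, ν W * c W * y W)
          - (∑ W ∈ U.powerset, ν W * c W) * (∑ W ∈ U.powerset, ν W * chainMix ∅ ent' 1 c d W * y W)) *
        ((∑ W ∈ U.powerset, ν W * c W) *
            ((∑ W ∈ U.powerset, ν W * chainMix ∅ ent' 1 c d W * x W)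
              - (∑ W ∈ U.powerset, ν W * chainMix ∅ ent' 1 c d' W * x W))
          - (∑ W ∈ U.powerset, ν W * c W * x W) *
            ((∑ W ∈ U.powerset, ν W * chainMix ∅ ent' 1 c d W)
              - (∑ W ∈ U.powerset, ν W * chainMix ∅ ent' 1 c d' W))) ≤ 0) ∨
      (((∑ W ∈ U.powerset, ν W * chainMix ∅ ent' 1 c d W) * (∑ W ∈ U.powerset, ν W * c W * x W)
          - (∑ W ∈ U.powerset, ν W * c W) * (∑ W ∈ U.powerset, ν W * chainMix ∅ ent' 1 c d W * x W)) *
        ((∑ W ∈ U.powerset, ν W * c W) *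
            ((∑ W ∈ U.powerset, ν W * chainMix ∅ ent' 1 c d W * y W)
              - (∑ W ∈ U.powerset, ν W * chainMix ∅ ent' 1 c d' W * y W))
          - (∑ W ∈ U.powerset, ν W * c W * y W) *
            ((∑ W ∈ U.powerset, ν W * chainMix ∅ ent' 1 c d W)
              - (∑ W ∈ U.powerset, ν W * chainMix ∅ ent' 1 c d' W))) ≤ 0) ∨
      (0 ≤ ∑ W ∈ U.powerset.filter (fun W => ∃ r ∈ ent', r ∈ W), ν W * d' W *
        (((∑ W ∈ U.powerset, ν W * chainMix ∅ ent' 1 c d W) * x W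
            - (∑ W ∈ U.powerset, ν W * chainMix ∅ ent' 1 c d W * x W)) *
          ((∑ W ∈ U.powerset, ν W * chainMix ∅ ent' 1 c d W) * y W
            - (∑ W ∈ U.powerset, ν W * chainMix ∅ ent' 1 c d W * y W)))) ∨
      (0 ≤ (∑ W ∈ U.powerset, ν W * c W) *
        (((∑ W ∈ U.powerset, ν W * chainMix ∅ ent' 1 c d W) * (∑ W ∈ U.powerset, ν W * c W * y W)
            - (∑ W ∈ U.powerset, ν W * c W) * (∑ W ∈ U.powerset, ν W * chainMix ∅ ent' 1 c d W * y W)) *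
          ((∑ W ∈ U.powerset, ν W * chainMix ∅ ent' 1 c d W) *
              (∑ W ∈ U.powerset, ν W * chainMix ∅ ent' 1 c d' W * x W)
            - (∑ W ∈ U.powerset, ν W * chainMix ∅ ent' 1 c d W * x W) *
              (∑ W ∈ U.powerset, ν W * chainMix ∅ ent' 1 c d' W))
        + ((∑ W ∈ U.powerset, ν W * chainMix ∅ ent' 1 c d W) * (∑ W ∈ U.powerset, ν W * c W * x W)
            - (∑ W ∈ U.powerset, ν W * c W) * (∑ W ∈ U.powerset, ν W * chainMix ∅ ent' 1 c d W * x W)) *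
          ((∑ W ∈ U.powerset, ν W * chainMix ∅ ent' 1 c d W) *
              (∑ W ∈ U.powerset, ν W * chainMix ∅ ent' 1 c d' W * y W)
            - (∑ W ∈ U.powerset, ν W * chainMix ∅ ent' 1 c d W * y W) *
              (∑ W ∈ U.powerset, ν W * chainMix ∅ ent' 1 c d' W)))
        + ((∑ W ∈ U.powerset, ν W * chainMix ∅ ent' 1 c d W) * (∑ W ∈ U.powerset, ν W * c W * x W)
            - (∑ W ∈ U.powerset, ν W * c W) * (∑ W ∈ U.powerset, ν W * chainMix ∅ ent' 1 c d W * x W)) *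
          ((∑ W ∈ U.powerset, ν W * chainMix ∅ ent' 1 c d W) * (∑ W ∈ U.powerset, ν W * c W * y W)
            - (∑ W ∈ U.powerset, ν W * c W) * (∑ W ∈ U.powerset, ν W * chainMix ∅ ent' 1 c d W * y W)) *
          ((∑ W ∈ U.powerset, ν W * chainMix ∅ ent' 1 c d W)
            - 2 * (∑ W ∈ U.powerset, ν W * chainMix ∅ ent' 1 c d' W))) ∨
      (0 ≤ (∑ W ∈ U.powerset, ν W * c W) ^ 2 *
        (((∑ W ∈ U.powerset, ν W * chainMix ∅ ent' 1 c d W) *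
            (∑ W ∈ U.powerset.filter (fun W => W ∩ ent' = ∅), ν W * c W * y W)
          - (∑ W ∈ U.powerset.filter (fun W => W ∩ ent' = ∅), ν W * c W) *
            (∑ W ∈ U.powerset, ν W * chainMix ∅ ent' 1 c d W * y W)) *
         ((∑ W ∈ U.powerset, ν W * chainMix ∅ ent' 1 c d W) *
            (∑ W ∈ U.powerset, ν W * chainMix ∅ ent' 1 c d' W * x W)
          - (∑ W ∈ U.powerset, ν W * chainMix ∅ ent' 1 c d W * x W) *
            (∑ W ∈ U.powerset, ν W * chainMix ∅ ent' 1 c d' W)))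
        + (∑ W ∈ U.powerset.filter (fun W => W ∩ ent' = ∅), ν W * c W) *
          (((∑ W ∈ U.powerset, ν W * chainMix ∅ ent' 1 c d W) -
              (∑ W ∈ U.powerset, ν W * chainMix ∅ ent' 1 c d' W)) *
            (((∑ W ∈ U.powerset, ν W * chainMix ∅ ent' 1 c d W) * (∑ W ∈ U.powerset, ν W * c W * x W)
                - (∑ W ∈ U.powerset, ν W * c W) * (∑ W ∈ U.powerset, ν W * chainMix ∅ ent' 1 c d W * x W)) *
              ((∑ W ∈ U.powerset, ν W * chainMix ∅ ent' 1 c d W) * (∑ W ∈ U.powerset, ν W * c W * y W)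
                - (∑ W ∈ U.powerset, ν W * c W) * (∑ W ∈ U.powerset, ν W * chainMix ∅ ent' 1 c d W * y W))))) ∨
      (0 ≤ (∑ W ∈ U.powerset, ν W * c W) ^ 2 *
        (((∑ W ∈ U.powerset, ν W * chainMix ∅ ent' 1 c d W) *
            (∑ W ∈ U.powerset.filter (fun W => W ∩ ent' = ∅), ν W * c W * x W)
          - (∑ W ∈ U.powerset.filter (fun W => W ∩ ent' = ∅), ν W * c W) *
            (∑ W ∈ U.powerset, ν W * chainMix ∅ ent' 1 c d W * x W)) *
         ((∑ W ∈ U.powerset, ν W * chainMix ∅ ent' 1 c d W) *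
            (∑ W ∈ U.powerset, ν W * chainMix ∅ ent' 1 c d' W * y W)
          - (∑ W ∈ U.powerset, ν W * chainMix ∅ ent' 1 c d W * y W) *
            (∑ W ∈ U.powerset, ν W * chainMix ∅ ent' 1 c d' W)))
        + (∑ W ∈ U.powerset.filter (fun W => W ∩ ent' = ∅), ν W * c W) *
          (((∑ W ∈ U.powerset, ν W * chainMix ∅ ent' 1 c d W) -
              (∑ W ∈ U.powerset, ν W * chainMix ∅ ent' 1 c d' W)) *
            (((∑ W ∈ U.powerset, ν W * chainMix ∅ ent' 1 c d W) * (∑ W ∈ U.powerset, ν W * c W * x W)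
                - (∑ W ∈ U.powerset, ν W * c W) * (∑ W ∈ U.powerset, ν W * chainMix ∅ ent' 1 c d W * x W)) *
              ((∑ W ∈ U.powerset, ν W * chainMix ∅ ent' 1 c d W) * (∑ W ∈ U.powerset, ν W * c W * y W)
                - (∑ W ∈ U.powerset, ν W * c W) * (∑ W ∈ U.powerset, ν W * chainMix ∅ ent' 1 c d W * y W))))) ∨
      (∃ θ : Finset V → R, (∀ W ∈ U.powerset.filter (fun W => ∃ r ∈ ent', r ∈ W),
      ((∑ W ∈ U.powerset, ν W * chainMix ∅ ent' 1 c d W) * x W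
          - (∑ W ∈ U.powerset, ν W * chainMix ∅ ent' 1 c d W * x W)) *
        ((∑ W ∈ U.powerset, ν W * chainMix ∅ ent' 1 c d W) * y W
          - (∑ W ∈ U.powerset, ν W * chainMix ∅ ent' 1 c d W * y W)) ≤ θ W) ∧ (0 ≤ (∑ W ∈ U.powerset, ν W * c W) ^ 2 *
        ((∑ W ∈ U.powerset, ν W * chainMix ∅ ent' 1 c d W) *
            ((∑ W ∈ U.powerset, ν W * chainMix ∅ ent' 1 c d W) *
              (∑ W ∈ U.powerset, ν W * chainMix ∅ ent' 1 c d W * (x W * y W))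
            - (∑ W ∈ U.powerset, ν W * chainMix ∅ ent' 1 c d W * x W) *
              (∑ W ∈ U.powerset, ν W * chainMix ∅ ent' 1 c d W * y W))
          - ∑ W ∈ U.powerset.filter (fun W => ∃ r ∈ ent', r ∈ W), ν W * (d W - d' W) * θ W)
        + ((∑ W ∈ U.powerset, ν W * chainMix ∅ ent' 1 c d W) -
            (∑ W ∈ U.powerset, ν W * chainMix ∅ ent' 1 c d' W)) *
          (((∑ W ∈ U.powerset, ν W * chainMix ∅ ent' 1 c d W) * (∑ W ∈ U.powerset, ν W * c W * x W)
              - (∑ W ∈ U.powerset, ν W * c W) * (∑ W ∈ U.powerset, ν W * chainMix ∅ ent' 1 c d W * x W)) *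
            ((∑ W ∈ U.powerset, ν W * chainMix ∅ ent' 1 c d W) * (∑ W ∈ U.powerset, ν W * c W * y W)
              - (∑ W ∈ U.powerset, ν W * c W) * (∑ W ∈ U.powerset, ν W * chainMix ∅ ent' 1 c d W * y W)))))) :
    0 ≤ (∑ W ∈ U.powerset, ν W * chainMix ∅ ent' ρ c d W) ^ 2 *
          (∑ W ∈ U.powerset, ν W * chainMix ∅ ent' ρ c d' W * (x W * y W))
        - (∑ W ∈ U.powerset, ν W * chainMix ∅ ent' ρ c d W) *
          (∑ W ∈ U.powerset, ν W * chainMix ∅ ent' ρ c d W * x W) *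
          (∑ W ∈ U.powerset, ν W * chainMix ∅ ent' ρ c d' W * y W)
        - (∑ W ∈ U.powerset, ν W * chainMix ∅ ent' ρ c d W) *
          (∑ W ∈ U.powerset, ν W * chainMix ∅ ent' ρ c d W * y W) *
          (∑ W ∈ U.powerset, ν W * chainMix ∅ ent' ρ c d' W * x W)
        + (∑ W ∈ U.powerset, ν W * chainMix ∅ ent' ρ c d W * x W) *
          (∑ W ∈ U.powerset, ν W * chainMix ∅ ent' ρ c d W * y W) *
          (∑ W ∈ U.powerset, ν W * chainMix ∅ ent' ρ c d' W) := by
  have hmI' : 0 < ∑ W ∈ U.powerset.filter (fun W => W ∩ ent' = ∅), ν W * c W := by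
    have e : U.powerset.filter (fun W => W ∩ ent' = ∅) =
        U.powerset.filter (fun W => ¬∃ r ∈ ent', r ∈ W) := by
      apply Finset.filter_congr
      intro W _
      rw [Finset.eq_empty_iff_forall_notMem]
      constructor
      · rintro h ⟨r, hr, hrW⟩
        exact h r (Finset.mem_inter.mpr ⟨hrW, hr⟩)
      · intro h r hr
        rw [Finset.mem_inter] at hr
        exact h ⟨r, hr.2, hr.1⟩
    rw [e]
    exact hmI
  rcases hcase with h | h | h | h | h | h | ⟨θ, hθ, h⟩
  · exact pureChain_functional_nonneg_of_pivotalX U ent' ν c d d' ρ hρ0 hρ1 hν0 hν hc0 hd0 hd'0 hdc hd'c hcc hdd hd'd' hcd hcd' hdd' hratio hratio' x y hx0 hy0 hxm hym hpos0 hpos1 h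
  · exact pureChain_functional_nonneg_of_pivotalY U ent' ν c d d' ρ hρ0 hρ1 hν0 hν hc0 hd0 hd'0 hdc hd'c hcc hdd hd'd' hcd hcd' hdd' hratio hratio' x y hx0 hy0 hxm hym hpos0 hpos1 h
  · exact pureChain_functional_nonneg_of_enteredPart U ent' ν c d d' ρ hρ0 hρ1 hν0 hν hc0 hd0 hd'0 hdc hd'c hd'd hcc hdd hd'd' hcd hcd' hdd' hratio hratio' x y hx0 hy0 hxm hym hpos0 hpos1 hmI h
  · exact pureChain_functional_nonneg_of_world0Corner U ent' ν c d d' ρ hρ0 hρ1 hν0 hν hc0 hd0 hd'0 hdc hd'c hcc hdd hd'd' hcd hcd' hdd' hratio hratio' x y hx0 hy0 hxm hym hpos0 hpos1 h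
  · exact pureChain_functional_nonneg_of_cslBaseY U ent' ν c d d' ρ hρ0 hρ1 hν0 hν hc0 hd0 hd'0 hdc hd'c hcc hdd hd'd' hcd hcd' hdd' hratio hratio' x y hx0 hy0 hxm hym hpos0 hpos1 hmI' h
  · exact pureChain_functional_nonneg_of_cslBaseX U ent' ν c d d' ρ hρ0 hρ1 hν0 hν hc0 hd0 hd'0 hdc hd'c hcc hdd hd'd' hcd hcd' hdd' hratio hratio' x y hx0 hy0 hxm hym hpos0 hpos1 hmI' h
  · exact pureChain_functional_nonneg_of_pivotalPart U ent' ν c d d' ρ hρ0 hρ1 hν0 hν hc0 hd0 hd'0 hdc hd'c hd'd hcc hdd hd'd' hcd hcd' hdd' hratio hratio' x y hx0 hy0 hxm hym hpos0 hpos1 θ hθ h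

end SixCases

end Summit.Ventures.PercRepro2.Coin
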